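import Summits.BirchSwinnertonDyer.BirchSwinnertonDyer.Theorems.Rank2ObservatoryRank3ModularDegreeParity
import Summits.BirchSwinnertonDyer.BirchSwinnertonDyer.Theorems.Rank2ObservatoryRank3ConductorTotal
import HarnessLib

/-!
# BirchSwinnertonDyer — rank ≥ 2 observatory: rank-3 census — EVEN MODULAR DEGREE GRANTING ONLY CALEGARI–EMERTON for the
# 5 190 rank-3 census curves whose conductor has at least three odd prime factors (kernel census of `ω_odd(N) ≥ 3`: 5 190 / 9 487)

HONEST FRAMING: per-curve certified theorems and census instruments; no claim on BSD in rank ≥ 2.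
Nothing here proves BSD, or finiteness of `Ш`, for any curve; nothing here bears on `ord_{s=1} L(E,s)`; no VALUE of any
modular degree is certified.  Companion of `Rank2ObservatoryRank3ModularDegreeParity` (even `m_E` for ALL 9 487 rows granting
Calegari–Emerton `hCE` AND the local-root-number facts `hKD`/`hR`, or the 2-parity theorem on the 986 two-torsion rows).
THIS file removes every hypothesis except `hCE` on a kernel-decided subset of the table.

WHAT.  The FIRST conclusion of Calegari–Emerton [CalegariEmerton2008, Theorem 1] (tree fact `calegariEmerton_oddModularDegree`):
if `m_E` is odd then the conductor `N` is divisible by AT MOST TWO odd primes.  Hence every elliptic curve whose conductor has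
THREE distinct odd prime factors has EVEN modular degree, granting only `hCE` — no root numbers, no torsion, no CM input.
On the rank-3 census the conductor VALUE is a kernel theorem for every row (`Rank3Row.conductorNorm_eq_of_mem`:
`conductorNorm ℤ r.curve = r.N`, cell index row 5, hypothesis-free), so the condition is integer arithmetic on `r.N`:

* §1 the arithmetic certificate: three pairwise-coprime odd divisors `> 1` of `N` force `3 ≤ #{odd primes dividing N}`
  (their least prime factors are three distinct odd primes dividing `N`; NO primality test is run in the kernel);
* §2 the row test `Rank3Row.threeOddB` (Bool): strip the powers of `2` from `r.N`, find the two smallest odd prime factors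
  among the odd primes `≤ 379` (the list `oddPrimes379`; `379` is the largest second-smallest odd prime factor occurring),
  strip them, and accept iff the remaining cofactor exceeds `1` — the accepted triple is then CHECKED by `ceTripleOK`
  (divisibility, oddness, pairwise `gcd = 1`); soundness `Rank3Row.two_lt_card_oddPrimeFactors_of_threeOddB` rests on the
  check alone, the search is untrusted;
* §3 per row: `threeOddB r = true ⇒ Even D.modularDegree` for every minimal modular parametrisation datum `D` of `r.curve`
  at level `conductorNorm ℤ r.curve`, granting ONLY `hCE`;
* §4 the kernel census: exactly `5 190` of the `9 487` rows pass `threeOddB` (one linear kernel walk; `ω_odd(N)`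
  histogram of the table, engine-side: `1: 814, 2: 3 483, 3: 3 927, 4: 1 207, 5: 56`), the other `4 297` rows keep the
  route of the companion file (`hCE + hKD + hR`).

Watkins' conjecture [Watkins2002, Conj. 4.1] predicts `8 ∣ m_E` on the whole table (Cremona's `alldegphi` confirms `2³ ∣ deg φ`
on all 9 487 rows, OUT of the kernel); the kernel now holds the first bit for 5 190 rows granting one named theorem in print,
and for all 9 487 granting three.  Pure glue BY NAME plus one Bool walk; no `native_decide`; no new certificates beyond the
walk; nothing claimed about `4 ∣ m_E`, modularity, `L‴`, `r_an`, `Ш`, BSD.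
-/

set_option linter.dupNamespace false
set_option autoImplicit false

open WeierstrassCurve Literature Literature.NumberTheory.EllipticCurves
  Literature.NumberTheory.EllipticCurves.ModularForms

namespace Summit.BirchSwinnertonDyer.BirchSwinnertonDyer.Rank2Observatory

/-! ### §1 The arithmetic certificate: three pairwise-coprime odd divisors `> 1` -/

/-- The CHECK of a triple `(a, b, c)` against `N`: `0 < N`, each of `a, b, c` exceeds `1`, is odd and divides `N`, and the
three are pairwise coprime (kernel-cheap: `mod` and `gcd` only, no primality). [folklore] -/
def ceTripleOK (N : ℕ) (t : ℕ × ℕ × ℕ) : Bool :=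
  decide (0 < N) && decide (1 < t.1) && decide (1 < t.2.1) && decide (1 < t.2.2) &&
    decide (t.1 % 2 = 1) && decide (t.2.1 % 2 = 1) && decide (t.2.2 % 2 = 1) &&
    decide (N % t.1 = 0) && decide (N % t.2.1 = 0) && decide (N % t.2.2 = 0) &&
    decide (Nat.gcd t.1 t.2.1 = 1) && decide (Nat.gcd t.1 t.2.2 = 1) && decide (Nat.gcd t.2.1 t.2.2 = 1)

/-- The least prime factor of an odd number `> 1` dividing `N ≠ 0` is an ODD prime factor of `N`. [folklore] -/
theorem minFac_mem_oddPrimeFactors {N a : ℕ} (hN : N ≠ 0) (ha : 1 < a) (hodd : a % 2 = 1) (hdvd : a ∣ N) :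
    a.minFac ∈ N.primeFactors.filter (fun q => q ≠ 2) := by
  rw [Finset.mem_filter, Nat.mem_primeFactors]
  refine ⟨⟨Nat.minFac_prime (by omega), (Nat.minFac_dvd a).trans hdvd, hN⟩, ?_⟩
  intro h2
  have h := Nat.minFac_dvd a
  rw [h2] at h
  omega

/-- Coprime numbers `> 1` have distinct least prime factors. [folklore] -/
theorem minFac_ne_minFac_of_gcd_eq_one {a b : ℕ} (ha : 1 < a) (hg : Nat.gcd a b = 1) : a.minFac ≠ b.minFac := by
  intro h
  have hp : a.minFac.Prime := Nat.minFac_prime (by omega)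
  have hd : a.minFac ∣ Nat.gcd a b := Nat.dvd_gcd (Nat.minFac_dvd a) (h ▸ Nat.minFac_dvd b)
  rw [hg, Nat.dvd_one] at hd
  exact hp.one_lt.ne' hd

/-- **Three pairwise-coprime odd divisors `> 1` of `N` force at least three odd prime factors of `N`.** [folklore] -/
theorem two_lt_card_oddPrimeFactors_of_ceTripleOK {N : ℕ} {t : ℕ × ℕ × ℕ} (h : ceTripleOK N t = true) :
    2 < (N.primeFactors.filter (fun q => q ≠ 2)).card := by
  obtain ⟨a, b, c⟩ := t
  simp only [ceTripleOK, Bool.and_eq_true, decide_eq_true_eq] at h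
  obtain ⟨⟨⟨⟨⟨⟨⟨⟨⟨⟨⟨⟨hN, ha⟩, hb⟩, hc⟩, hao⟩, hbo⟩, hco⟩, had⟩, hbd⟩, hcd⟩, hab⟩, hac⟩, hbc⟩ := h
  have hN' : N ≠ 0 := by omega
  have hma := minFac_mem_oddPrimeFactors hN' ha hao (Nat.dvd_of_mod_eq_zero had)
  have hmb := minFac_mem_oddPrimeFactors hN' hb hbo (Nat.dvd_of_mod_eq_zero hbd)
  have hmc := minFac_mem_oddPrimeFactors hN' hc hco (Nat.dvd_of_mod_eq_zero hcd)
  have h1 := minFac_ne_minFac_of_gcd_eq_one ha hab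
  have h2 := minFac_ne_minFac_of_gcd_eq_one ha hac
  have h3 := minFac_ne_minFac_of_gcd_eq_one hb hbc
  have hsub : ({a.minFac, b.minFac, c.minFac} : Finset ℕ) ⊆ N.primeFactors.filter (fun q => q ≠ 2) := by
    intro x hx
    simp only [Finset.mem_insert, Finset.mem_singleton] at hx
    rcases hx with rfl | rfl | rfl
    exacts [hma, hmb, hmc]
  have hcard : ({a.minFac, b.minFac, c.minFac} : Finset ℕ).card = 3 :=
    Finset.card_eq_three.mpr ⟨_, _, _, h1, h2, h3, rfl⟩
  have := Finset.card_le_card hsub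
  omega

/-! ### §2 The row test (untrusted search + checked certificate) -/

/-- The odd primes `≤ 379` (74 of them; `379` = the largest second-smallest odd prime factor of a conductor of the table with
`ω_odd(N) ≥ 3`).  Only used to SEARCH; the found triple is re-checked by `ceTripleOK`. [folklore] -/
def oddPrimes379 : List ℕ :=
  [3, 5, 7, 11, 13, 17, 19, 23, 29, 31, 37, 41, 43, 47, 53, 59, 61, 67, 71, 73, 79, 83, 89, 97, 101, 103, 107, 109, 113, 127,
   131, 137, 139, 149, 151, 157, 163, 167, 173, 179, 181, 191, 193, 197, 199, 211, 223, 227, 229, 233, 239, 241, 251, 257, 263,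
   269, 271, 277, 281, 283, 293, 307, 311, 313, 317, 331, 337, 347, 349, 353, 359, 367, 373, 379]

/-- Strip the factor `p` from `n` at most `fuel` times (structural recursion on `fuel`; `2^20 > 5·10^5`). [folklore] -/
def stripFactor (p : ℕ) : ℕ → ℕ → ℕ
  | 0, n => n
  | fuel + 1, n => if 1 < p ∧ 0 < n ∧ n % p = 0 then stripFactor p fuel (n / p) else n

/-- The untrusted witness search: `(p, q, m)` = the two smallest odd prime factors of `N` below `380` and the odd cofactor
left after stripping `2`, `p`, `q`. [folklore] -/
def ceWitness (N : ℕ) : Option (ℕ × ℕ × ℕ) :=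
  let n₀ := stripFactor 2 20 N
  match oddPrimes379.find? (fun p => n₀ % p == 0) with
  | none => none
  | some p =>
    let n₁ := stripFactor p 20 n₀
    match oddPrimes379.find? (fun q => n₁ % q == 0) with
    | none => none
    | some q => some (p, q, stripFactor q 20 n₁)

/-- **The row test**: the conductor field `r.N` admits a CHECKED triple of pairwise-coprime odd divisors `> 1`.
[cite: CremonaAlgorithms1997, Tables] -/
def Rank3Row.threeOddB (r : Rank3Row) : Bool :=
  match ceWitness r.N with
  | none => false
  | some t => ceTripleOK r.N t

/-- Soundness of the row test: `threeOddB r ⇒ ω_odd(r.N) ≥ 3`. [folklore] -/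
theorem Rank3Row.two_lt_card_oddPrimeFactors_of_threeOddB {r : Rank3Row} (h : r.threeOddB = true) :
    2 < (r.N.primeFactors.filter (fun q => q ≠ 2)).card := by
  unfold Rank3Row.threeOddB at h
  split at h
  · exact absurd h Bool.false_ne_true
  · exact two_lt_card_oddPrimeFactors_of_ceTripleOK h

/-! ### §3 Per row: even modular degree granting ONLY Calegari–Emerton -/

/-- **Granting only Calegari–Emerton (`hCE`): an elliptic curve over `ℚ` whose conductor has at least three odd prime factors
has EVEN modular degree** (the first conclusion of [CalegariEmerton2008, Theorem 1], contrapositively).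
[cite: CalegariEmerton2008, Theorem 1 (arXiv:math/0503359, p. 2)] -/
theorem ModularDegreeParity.even_of_two_lt_card_oddPrimeFactors (hCE : calegariEmerton_oddModularDegree)
    (W : WeierstrassCurve ℚ) [W.IsElliptic] [NeZero (W.conductorNorm ℤ)]
    (D : ModularParametrizationData W (W.conductorNorm ℤ))
    (hmin : ∀ D' : ModularParametrizationData W (W.conductorNorm ℤ), D.modularDegree ≤ D'.modularDegree)
    (h3 : 2 < ((W.conductorNorm ℤ).primeFactors.filter (fun q => q ≠ 2)).card) : Even D.modularDegree := by
  rcases Nat.even_or_odd D.modularDegree with he | ho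
  · exact he
  · obtain ⟨hle, -, -⟩ := hCE W D hmin ho
    omega

/-- **Per row — the 5 190 rank-3 census curves with `ω_odd(N) ≥ 3`, granting ONLY Calegari–Emerton: the modular degree is
EVEN** (conductor value by `Rank3Row.conductorNorm_eq_of_mem`, kernel; row test `threeOddB`, kernel).
[cite: CalegariEmerton2008, Theorem 1 (arXiv:math/0503359, p. 2)] [cite: Watkins2002, Conjecture 4.1 (p. 498)]
[cite: CremonaAlgorithms1997, Tables] -/
theorem Rank3Row.even_modularDegree_of_threeOddB (hCE : calegariEmerton_oddModularDegree) {r : Rank3Row}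
    (hr : r ∈ rank3Table) (h3 : r.threeOddB = true)
    [NeZero (r.curve.conductorNorm ℤ)] (D : ModularParametrizationData r.curve (r.curve.conductorNorm ℤ))
    (hmin : ∀ D' : ModularParametrizationData r.curve (r.curve.conductorNorm ℤ), D.modularDegree ≤ D'.modularDegree) :
    Even D.modularDegree := by
  haveI := isElliptic_of_mem hr
  refine ModularDegreeParity.even_of_two_lt_card_oddPrimeFactors hCE r.curve D hmin ?_
  rw [Rank3Row.conductorNorm_eq_of_mem hr]
  exact Rank3Row.two_lt_card_oddPrimeFactors_of_threeOddB h3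

/-- Per row at an arbitrary level term `N` provably equal to the conductor, granting only `hCE`.
[cite: CalegariEmerton2008, Theorem 1 (arXiv:math/0503359, p. 2)] -/
theorem Rank3Row.even_modularDegree_at_level_of_threeOddB (hCE : calegariEmerton_oddModularDegree) {r : Rank3Row}
    (hr : r ∈ rank3Table) (h3 : r.threeOddB = true) {N : ℕ} [NeZero N] (hN : r.curve.conductorNorm ℤ = N)
    (D : ModularParametrizationData r.curve N)
    (hmin : ∀ D' : ModularParametrizationData r.curve N, D.modularDegree ≤ D'.modularDegree) : Even D.modularDegree := by
  subst hN
  exact Rank3Row.even_modularDegree_of_threeOddB hCE hr h3 D hmin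

/-! ### §4 The kernel census of the row test -/

/-- **Exactly `5 190` of the `9 487` rank-3 census rows pass `threeOddB`** (one linear kernel walk over `rank3Table`).
[cite: CremonaAlgorithms1997, Tables] -/
theorem rank3Table_countP_threeOddB : rank3Table.countP Rank3Row.threeOddB = 5190 := by
  decide +kernel

/-- **THE MODULAR-DEGREE PARITY OF THE RANK-3 CENSUS GRANTING ONLY CALEGARI–EMERTON.**  (1) `5 190` of the `9 487` rows pass
the kernel test `ω_odd(N) ≥ 3`; (2) each of them has even modular degree granting only `hCE`; (3) every row whatsoever has even
modular degree granting `hCE + hKD + hR` (companion file, by name).  Watkins predicts `2³ ∣ m_E` throughout; the kernel holds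
the first bit.  HONEST FRAMING: per-curve certified theorems and census instruments; no claim on BSD in rank ≥ 2.
[cite: CalegariEmerton2008, Theorem 1 (arXiv:math/0503359, p. 2)] [cite: Watkins2002, Conjecture 4.1 (p. 498)] -/
theorem rank3_modularDegreeParity_CE (hCE : calegariEmerton_oddModularDegree) :
    rank3Table.countP Rank3Row.threeOddB = 5190 ∧ rank3Table.length = 9487 ∧
    (∀ r ∈ rank3Table, r.threeOddB = true →
      ∀ [NeZero (r.curve.conductorNorm ℤ)] (D : ModularParametrizationData r.curve (r.curve.conductorNorm ℤ)),
        (∀ D' : ModularParametrizationData r.curve (r.curve.conductorNorm ℤ), D.modularDegree ≤ D'.modularDegree) →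
        Even D.modularDegree) ∧
    (∀ r ∈ rank3Table, r.curve.rootNumber_eq_neg_finprod_tableLocalRootNumberAt' →
      r.curve.rootNumber_eq_neg_finprod_fullTableLocalRootNumberAt →
      ∀ [NeZero (r.curve.conductorNorm ℤ)] (D : ModularParametrizationData r.curve (r.curve.conductorNorm ℤ)),
        (∀ D' : ModularParametrizationData r.curve (r.curve.conductorNorm ℤ), D.modularDegree ≤ D'.modularDegree) →
        Even D.modularDegree) :=
  ⟨rank3Table_countP_threeOddB, rank3Table_length,
   fun _ hr h3 _ D hmin => Rank3Row.even_modularDegree_of_threeOddB hCE hr h3 D hmin,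
   fun _ hr hKD hR _ D hmin => Rank3Row.even_modularDegree_of_mem hCE hr hKD hR D hmin⟩

end Summit.BirchSwinnertonDyer.BirchSwinnertonDyer.Rank2Observatory
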